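import Literature.AnabelianGeometry.SemiGraphs.SubgraphComponentsDoubleCosetsOfEssentialBranches
import Literature.AnabelianGeometry.SemiGraphs.CoveringBranchFrames
import Literature.AnabelianGeometry.SemiGraphs.CommensurabilityProp25iProofs
import HarnessLib

/-!
# (D3) `covering_subgraphComponents_doubleCosets` WITHOUT branch alignment under print's hypotheses: quasi-coherent graphs of anabelioids, ELEVATED vertices ([SemiAnbd] Def. 2.4 (i) p. 25, Cor. 2.7 (i) p. 30)

Mochizuki, *Semi-graphs of anabelioids*, Publ. RIMS **42** (2006), §2: Def. 2.4 (i) p. 25 (elevated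
vertices), Prop. 2.5 (i) p. 27 (`Π_v ↪ Π_𝒢` for quasi-coherent graphs of anabelioids), proof of
Cor. 2.7 (i) p. 30 ("[as one verifies immediately] `ℋ′` injects into `𝒢′` as a subgraph" — Cor. 2.7
assumes `𝒢` a connected quasi-coherent graph of anabelioids and the vertices of `ℍ` elevated)
[cite: MochizukiSemiAnbd2006, Cor. 2.7(i) p.30].

PROOF-ONLY (abc-iut cell, layer L3; FACT-LIST row F-1487 `covering_subgraphComponents_doubleCosets`
AS TYPED — local ∧ global ∧ vertex-aligned, NO branch alignment —, CLASS route, brick R6 corollary E4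
«PRINT'S HYPOTHESES»; seat abc-iut-f-161 (gen 13)).  E3
(`covering_subgraphComponents_doubleCosets_of_essentialBranches`) closes the class of connected `𝒢`
whose closed-edge branches are Π-ESSENTIAL.  This file derives Π-essentiality from print's Def. 2.4 (i):

* (private) `card_le_index_of_inf_eq_bot` — a subgroup meeting `H` trivially has at most `[G : H]`
  elements;
* `not_le_branchSubgroup_of_isElevated` — at an ELEVATED vertex `v` no open subgroup of
  `Π_v = Aut F` lies in a branch group `Π_b^α` (a `π₁`-epimorphic approximator of level `> [Π_v : U]`
  carries `U` onto a subgroup of index `≤ [Π_v : U]` inside the aligned image of `Π_b`, which a subgroup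
  of order `> [Π_v : U]` meets trivially — contradiction; uses abc-iut-L6-t17/L4's
  `map_branchSubgroup_le_aligned`);
* `exists_not_mem_map_branchSubgroup_of_isElevated` — with `Π_v → Π_𝒢` injective, the E3 binder
  (Π-essentiality) at every branch of an elevated vertex;
* `covering_subgraphComponents_doubleCosets_of_isTotallyElevated` — **(D3) AS TYPED for every `A`
  and every covering, over every connected `𝒢` with injective `Π_v → Π_𝒢` all of whose vertices are
  ELEVATED**; `…_of_isTotallyElevated_of_isQuasiCoherent` — the same for connected quasi-coherent
  totally elevated GRAPHS of anabelioids (`Π_v ↪ Π_𝒢` by abc-iut's `piVToPi_injective`, Prop. 2.5 (i));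
* `covering_subgraphComponents_doubleCosets_of_isElevated` — **the dictionary step EXACTLY AS USED IN
  THE PROOF OF COR. 2.7 (i): for connected `𝒢` with injective `Π_v → Π_𝒢`, the body of (D3) for every
  covering and every connected sub-graph `ℍ` ALL OF WHOSE VERTICES ARE ELEVATED** (a NEW statement
  shape: the (D3) body with print's hypothesis on `ℍ` inserted; detection is needed only over
  `ℍ.edges`, E2c); `…_of_isElevated_of_isQuasiCoherent` — the same over connected quasi-coherent graphs
  of anabelioids, i.e. under the standing hypotheses of [SemiAnbd] Cor. 2.7 (i) verbatim.

TOKEN (abc-iut-L3-lead ζ22, verbatim): «(D3) AS TYPED for every `A ∈ B(𝒢)` and every local ∧ global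
∧ vertex-aligned covering `φ : 𝒢′ → 𝒢`, over every connected quasi-coherent graph of anabelioids `𝒢`
and every connected sub-graph `ℍ` all of whose vertices are ELEVATED (Def 2.4 (i) AS TYPED) — print's
Cor 2.7 (i) setting with abstract `φ`; F-1487's bare ∀ (all semi-graphs of anabelioids, no elevation)
stays OPEN-AS-TYPED (δ22); residual = non-elevated (HAIR) vertices = R7».

HONEST SCOPE.  [SemiAnbd] Cor. 2.7 (i) ITSELF already holds UNCONDITIONALLY in the tree
(`Corollary27iHolds.lean`, RS route; `Corollary27iHoldsViaDecompositionGroups.lean`, via (D3) at the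
CONSTRUCTED covering `A.coveringHomCan`) — this file is NOT needed for Cor. 2.7 (i) and changes no
FACT-LIST label; its content is (D3) for ABSTRACT local ∧ global ∧ vertex-aligned `φ` (NO branch
alignment) under print's standing hypotheses (connected quasi-coherent graph of anabelioids; `ℍ` a
connected sub-graph with elevated vertices).  CLASS-route / re-hypothesised closers; F-1487 AS TYPED
(all `𝒢`, all `ℍ`) stays OPEN-AS-TYPED (L3-lead δ22); CLASS CLOSER ≠ the fact; typed ≠ proved; no
definition, no instance, no new named fact; nothing here takes a side on [IUTchIII] Cor. 3.12.
-/

namespace Literature.AnabelianGeometry.SemiGraphs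

namespace SemiGraphOfAnabelioids

open CategoryTheory CategoryTheory.Limits CategoryTheory.Functor CategoryTheory.PreGaloisCategory
open Literature.AnabelianGeometry.Anabelioids
open scoped Pointwise

universe v₁ u₁ u

variable {𝒢 𝒢' : SemiGraphOfAnabelioids.{v₁, u₁, u}}

/-! ### Elevated vertices: no open subgroup of `Π_v` lies in an edge group -/

/-- A subgroup `N` meeting `H` trivially injects into `G ⧸ H`, so `|N| ≤ [G : H]` when the index is
finite (no Mathlib lemma of this exact shape was found by `lean search` over `GroupTheory.Index`,
`GroupTheory.Coset.Card`, `GroupTheory.Complement`: `card_le_index`, `inf_eq_bot`, `Disjoint`). [folklore] -/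
private theorem card_le_index_of_inf_eq_bot {G : Type*} [Group G] (N H : Subgroup G) (h : N ⊓ H = ⊥)
    [Finite (G ⧸ H)] : Nat.card N ≤ H.index := by
  refine Nat.card_le_card_of_injective (fun n : N => ((n : G) : G ⧸ H)) fun n₁ n₂ h12 => ?_
  have hmem : ((n₁ : G)⁻¹ * n₂) ∈ N ⊓ H := ⟨N.mul_mem (N.inv_mem n₁.2) n₂.2, QuotientGroup.eq.mp h12⟩
  rw [h] at hmem
  exact Subtype.ext (inv_mul_eq_one.mp (Subgroup.mem_bot.mp hmem))

set_option backward.isDefEq.respectTransparency false in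
/-- **At an ELEVATED vertex no open subgroup of `Π_v` lies in a branch group** ([SemiAnbd] Def. 2.4
(i) p. 25).  If `U ≤ Π_b^α` were open, of index `k` in the profinite `Π_v = Aut F`, take a
`π₁`-epimorphic approximator `𝒢 → 𝒢′` with a subgroup `N ≤ Π′_v` of order `≥ k + 1` meeting every
conjugate of every branch group of `𝒢′` at `v` trivially: the image of `U` in `Π′_v` has index `∣ k`
(surjectivity) and lies in the aligned image of `Π_b^α`, a branch group of `𝒢′`
(`map_branchSubgroup_le_aligned`), so `N` injects into a set of `≤ k` cosets — contradiction.
[cite: MochizukiSemiAnbd2006, Def. 2.4(i) p.25] -/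
theorem not_le_branchSubgroup_of_isElevated {v : 𝒢.graph.Vertex} (hv : 𝒢.IsElevated v)
    (F : 𝒢.V v ⥤ FintypeCat.{v₁}) [FiberFunctor F] (b : 𝒢.graph.Branch)
    (h : 𝒢.graph.abuts b = some v) (Fe : 𝒢.E (𝒢.graph.edgeOf b) ⥤ FintypeCat.{v₁}) [FiberFunctor Fe]
    (α : (𝒢.pull b v h).pullback ⋙ Fe ≅ F) (U : Subgroup (𝒢.PiV v F))
    (hU : IsOpen (U : Set (𝒢.PiV v F))) : ¬ U ≤ 𝒢.branchSubgroup F b h Fe α := by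
  intro hle
  -- `U` has finite index `k ≠ 0`
  haveI : DiscreteTopology (𝒢.PiV v F ⧸ U) := QuotientGroup.discreteTopology_iff.mpr hU
  haveI : Finite (𝒢.PiV v F ⧸ U) := finite_of_compact_of_discrete
  have hk0 : U.index ≠ 0 := Subgroup.index_ne_zero_of_finite
  -- an approximator of level `k + 1`
  obtain ⟨𝒢₁, ψ, hψ, hN⟩ := hv (U.index + 1) (Nat.succ_le_succ (Nat.zero_le _))
  let P : 𝒢₁.V (ψ.base.vertexMap v) ⥤ 𝒢.V v := (ψ.φV v).pullback
  haveI : PreservesFiniteLimits P := (ψ.φV v).property.1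
  haveI : PreservesFiniteColimits P := (ψ.φV v).property.2
  let F₁ : 𝒢₁.V (ψ.base.vertexMap v) ⥤ FintypeCat.{v₁} := P ⋙ F
  haveI : FiberFunctor F₁ := fiberFunctor_comp_of_exact _ F
  obtain ⟨N, hNfin, hNcard, hNbot⟩ := hN F₁
  -- the aligned frame of `𝒢₁` at `ψ b`
  let Pe := (ψ.φE (𝒢.graph.edgeOf b) (𝒢₁.graph.edgeOf (ψ.base.branchMap b))
    (by exact (ψ.base.edgeOf_branchMap b).symm)).pullback
  haveI : PreservesFiniteLimits Pe := (ψ.φE _ _ _).property.1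
  haveI : PreservesFiniteColimits Pe := (ψ.φE _ _ _).property.2
  haveI : FiberFunctor (Pe ⋙ Fe) := fiberFunctor_comp_of_exact _ Fe
  have hal := map_branchSubgroup_le_aligned ψ b v h (ψ.base.branchMap b) rfl F Fe α
  have hbot := hNbot (ψ.base.branchMap b) (ψ.base.abuts_branchMap b v h) (Pe ⋙ Fe)
    (ψ.alignIso b v h (ψ.base.branchMap b) rfl F Fe α) 1
  rw [map_one, one_smul] at hbot
  -- the image of `U`
  let θ := pi1Map (ψ.φV v).pullback F
  have hθ : Function.Surjective θ := hψ.isPi1Epi_V v F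
  have hUle : U.map θ ≤ 𝒢₁.branchSubgroup F₁ (ψ.base.branchMap b) (ψ.base.abuts_branchMap b v h)
      (Pe ⋙ Fe) (ψ.alignIso b v h (ψ.base.branchMap b) rfl F Fe α) :=
    (Subgroup.map_mono hle).trans hal
  have hdisj : N ⊓ U.map θ = ⊥ := by
    rw [eq_bot_iff] at hbot ⊢
    exact fun x hx => hbot ⟨hx.1, hUle hx.2⟩
  -- counting
  have hdvd : (U.map θ).index ∣ U.index := U.index_map_dvd hθ
  have hidx0 : (U.map θ).index ≠ 0 := fun h0 => hk0 (Nat.eq_zero_of_zero_dvd (h0 ▸ hdvd))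
  haveI : Finite (𝒢₁.PiV (ψ.base.vertexMap v) F₁ ⧸ U.map θ) :=
    Subgroup.index_ne_zero_iff_finite.mp hidx0
  have h1 : Nat.card N ≤ (U.map θ).index := card_le_index_of_inf_eq_bot N _ hdisj
  have h2 : (U.map θ).index ≤ U.index := Nat.le_of_dvd (Nat.pos_of_ne_zero hk0) hdvd
  omega

/-- **Π-ESSENTIALITY at an elevated vertex with `Π_v ↪ Π_𝒢`**: for every frame `(F, F_e, α)` at a
branch `b ∋ v`, `v` elevated, and every OPEN `U ≤ Π_v`, some `u ∈ U` does not map into the edge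
decomposition group `D_b = α(Π_b) ≤ Π` — the binder of
`covering_subgraphComponents_doubleCosets_of_essentialBranches` (injectivity turns «not in `D_b`»
into «not in `Π_b^α`»). [cite: MochizukiSemiAnbd2006, Def. 2.4(i) p.25] -/
theorem exists_not_mem_map_branchSubgroup_of_isElevated {v : 𝒢.graph.Vertex} (hv : 𝒢.IsElevated v)
    (F : 𝒢.V v ⥤ FintypeCat.{v₁}) [FiberFunctor F] (hinj : Function.Injective (𝒢.piVToPi v F))
    (b : 𝒢.graph.Branch) (h : 𝒢.graph.abuts b = some v)
    (Fe : 𝒢.E (𝒢.graph.edgeOf b) ⥤ FintypeCat.{v₁}) [FiberFunctor Fe]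
    (α : (𝒢.pull b v h).pullback ⋙ Fe ≅ F) (U : Subgroup (𝒢.PiV v F))
    (hU : IsOpen (U : Set (𝒢.PiV v F))) :
    ∃ u ∈ U, 𝒢.piVToPi v F u ∉ (𝒢.branchSubgroup F b h Fe α).map (𝒢.piVToPi v F) := by
  by_contra hcon
  refine not_le_branchSubgroup_of_isElevated hv F b h Fe α U hU fun u hu => ?_
  by_contra hu'
  refine hcon ⟨u, hu, fun hmem => hu' ?_⟩
  obtain ⟨w, hw, hwu⟩ := hmem
  rwa [← hinj hwu]

/-! ### (D3) over totally elevated bases -/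

/-- **(D3) AS TYPED over every connected `𝒢` with `Π_v ↪ Π_𝒢` all of whose vertices are ELEVATED**
([SemiAnbd] Def. 2.4 (i) p. 25; Cor. 2.7 (i) p. 30, "`ℋ′` injects into `𝒢′` as a subgraph"; Def. 2.2
(i) at the TYPED notion of morphism: local ∧ global ∧ vertex-aligned, NO branch alignment): every
closed-edge branch is Π-essential (`exists_not_mem_map_branchSubgroup_of_isElevated`), so E3
`covering_subgraphComponents_doubleCosets_of_essentialBranches` applies.  CLASS CLOSER only: the typed
fact, which quantifies over all `𝒢`, is not asserted. [cite: MochizukiSemiAnbd2006, Cor. 2.7(i) p.30] -/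
theorem covering_subgraphComponents_doubleCosets_of_isTotallyElevated :
    ∀ (𝒢 𝒢' : SemiGraphOfAnabelioids.{v₁, u₁, u}) (φ : Hom 𝒢' 𝒢) (A : 𝒢.BObj),
      𝒢.IsConnected → 𝒢'.IsConnected → φ.IsFiniteEtaleCoveringOf A → φ.IsGlobalCoveringOf A →
      φ.IsVertexAligned →
      (∀ (v : 𝒢.graph.Vertex) (F : 𝒢.V v ⥤ FintypeCat.{v₁}) [FiberFunctor F],
          Function.Injective (𝒢.piVToPi v F)) →
      𝒢.IsTotallyElevated →
      ∀ (v' : 𝒢'.graph.Vertex) (F' : 𝒢'.V v' ⥤ FintypeCat.{v₁}) [FiberFunctor F']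
        (F : 𝒢.V (φ.base.vertexMap v') ⥤ FintypeCat.{v₁}) [FiberFunctor F]
        (e : (φ.φV v').pullback ⋙ F' ≅ F)
        (H : 𝒢.graph.Subgraph), H.toSemiGraph.IsConnected → H.toSemiGraph.IsGraph →
        ∀ (hv : φ.base.vertexMap v' ∈ H.verts),
        let v := φ.base.vertexMap v'
        let ι : 𝒢'.Pi v' F' →* 𝒢.Pi v F :=
          (Aut.autMulEquivOfIso (Functor.isoWhiskerLeft (𝒢.ρ v) e)).toMonoidHom.comp
            (pi1Map φ.pullbackFunctor (𝒢'.ρ v' ⋙ F'))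
        let PH : Subgroup (𝒢.Pi v F) := (𝒢.piHToPi H ⟨v, hv⟩ F).range
        ∀ x₀ : (𝒢.ρ v ⋙ F).obj A, ι.range = MulAction.stabilizer (𝒢.Pi v F) x₀ →
          ∃ d : {K : 𝒢'.graph.Subgraph // φ.IsPreimageComponent H K} → 𝒢.Pi v F,
            Function.Bijective (fun K => DoubleCoset.mk PH ι.range (d K)) ∧
            (∃ K₀ : {K : 𝒢'.graph.Subgraph // φ.IsPreimageComponent H K}, v' ∈ K₀.1.verts) ∧
            (∀ (K : {K : 𝒢'.graph.Subgraph // φ.IsPreimageComponent H K}) (hK : v' ∈ K.1.verts),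
              d K ∈ ι.range ∧ (ι.comp (𝒢'.piHToPi K.1 ⟨v', hK⟩ F')).range = ι.range ⊓ PH) ∧
            ∀ (K : {K : 𝒢'.graph.Subgraph // φ.IsPreimageComponent H K})
              (w'' : K.1.toSemiGraph.Vertex) (F'' : 𝒢'.V w''.1 ⥤ FintypeCat.{v₁}) [FiberFunctor F'']
              (α : 𝒢'.ρ w''.1 ⋙ F'' ≅ 𝒢'.ρ v' ⋙ F'),
              ∃ g : 𝒢.Pi v F,
                (ι.comp ((Aut.autMulEquivOfIso α).toMonoidHom.comp (𝒢'.piHToPi K.1 w'' F''))).range =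
                  ι.range ⊓ ConjAct.toConjAct g⁻¹ • PH := by
  intro 𝒢 𝒢' φ A h𝒢 h𝒢' hloc hB hva hinj hel
  refine covering_subgraphComponents_doubleCosets_of_essentialBranches 𝒢 𝒢' φ A h𝒢 h𝒢' hloc hB hva ?_
  intro v F _ b h _ Fe _ α U hU
  exact exists_not_mem_map_branchSubgroup_of_isElevated (hel.isElevated v) F (hinj v F) b h Fe α U hU

/-- **(D3) AS TYPED over every connected, quasi-coherent, totally elevated GRAPH of anabelioids**
([SemiAnbd] Prop. 2.5 (i) p. 27: `Π_v ↪ Π_𝒢` for quasi-coherent graphs of anabelioids — abc-iut's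
`piVToPi_injective`; then `covering_subgraphComponents_doubleCosets_of_isTotallyElevated`).  CLASS
CLOSER only. [cite: MochizukiSemiAnbd2006, Cor. 2.7(i) p.30] -/

theorem covering_subgraphComponents_doubleCosets_of_isTotallyElevated_of_isQuasiCoherent :
    ∀ (𝒢 𝒢' : SemiGraphOfAnabelioids.{v₁, u₁, u}) (φ : Hom 𝒢' 𝒢) (A : 𝒢.BObj),
      𝒢.IsConnected → 𝒢'.IsConnected → φ.IsFiniteEtaleCoveringOf A → φ.IsGlobalCoveringOf A →
      φ.IsVertexAligned →
      𝒢.IsGraphOfAnabelioids → 𝒢.IsQuasiCoherent → 𝒢.IsTotallyElevated →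
      ∀ (v' : 𝒢'.graph.Vertex) (F' : 𝒢'.V v' ⥤ FintypeCat.{v₁}) [FiberFunctor F']
        (F : 𝒢.V (φ.base.vertexMap v') ⥤ FintypeCat.{v₁}) [FiberFunctor F]
        (e : (φ.φV v').pullback ⋙ F' ≅ F)
        (H : 𝒢.graph.Subgraph), H.toSemiGraph.IsConnected → H.toSemiGraph.IsGraph →
        ∀ (hv : φ.base.vertexMap v' ∈ H.verts),
        let v := φ.base.vertexMap v'
        let ι : 𝒢'.Pi v' F' →* 𝒢.Pi v F :=
          (Aut.autMulEquivOfIso (Functor.isoWhiskerLeft (𝒢.ρ v) e)).toMonoidHom.comp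
            (pi1Map φ.pullbackFunctor (𝒢'.ρ v' ⋙ F'))
        let PH : Subgroup (𝒢.Pi v F) := (𝒢.piHToPi H ⟨v, hv⟩ F).range
        ∀ x₀ : (𝒢.ρ v ⋙ F).obj A, ι.range = MulAction.stabilizer (𝒢.Pi v F) x₀ →
          ∃ d : {K : 𝒢'.graph.Subgraph // φ.IsPreimageComponent H K} → 𝒢.Pi v F,
            Function.Bijective (fun K => DoubleCoset.mk PH ι.range (d K)) ∧
            (∃ K₀ : {K : 𝒢'.graph.Subgraph // φ.IsPreimageComponent H K}, v' ∈ K₀.1.verts) ∧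
            (∀ (K : {K : 𝒢'.graph.Subgraph // φ.IsPreimageComponent H K}) (hK : v' ∈ K.1.verts),
              d K ∈ ι.range ∧ (ι.comp (𝒢'.piHToPi K.1 ⟨v', hK⟩ F')).range = ι.range ⊓ PH) ∧
            ∀ (K : {K : 𝒢'.graph.Subgraph // φ.IsPreimageComponent H K})
              (w'' : K.1.toSemiGraph.Vertex) (F'' : 𝒢'.V w''.1 ⥤ FintypeCat.{v₁}) [FiberFunctor F'']
              (α : 𝒢'.ρ w''.1 ⋙ F'' ≅ 𝒢'.ρ v' ⋙ F'),
              ∃ g : 𝒢.Pi v F,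
                (ι.comp ((Aut.autMulEquivOfIso α).toMonoidHom.comp (𝒢'.piHToPi K.1 w'' F''))).range =
                  ι.range ⊓ ConjAct.toConjAct g⁻¹ • PH := by
  intro 𝒢 𝒢' φ A h𝒢 h𝒢' hloc hB hva hgr hqc hel
  exact covering_subgraphComponents_doubleCosets_of_isTotallyElevated 𝒢 𝒢' φ A h𝒢 h𝒢' hloc hB hva
    (fun v F _ => piVToPi_injective hgr hqc v F) hel

/-! ### (D3) for sub-graphs with elevated vertices — the hypotheses of [SemiAnbd] Cor. 2.7 (i) -/

/-- The vertex of an abutting branch on an edge of a sub-GRAPH lies in the sub-graph.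
[cite: MochizukiSemiAnbd2006, §1 p.12] -/
theorem mem_verts_of_abuts_of_mem_edges (H : 𝒢.graph.Subgraph) (hHg : H.toSemiGraph.IsGraph)
    {b : 𝒢.graph.Branch} (hb : 𝒢.graph.edgeOf b ∈ H.edges) {v : 𝒢.graph.Vertex}
    (h : 𝒢.graph.abuts b = some v) : v ∈ H.verts := by
  obtain ⟨w, hw⟩ := Option.isSome_iff_exists.mp (hHg.abuts_isSome ⟨b, hb⟩)
  have hw' := (SemiGraph.Subgraph.abuts_eq_some_iff H _ _).mp hw
  rw [h] at hw'
  obtain rfl : v = w.1 := Option.some_injective _ hw'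
  exact w.2

/-- **The dictionary step (D3) EXACTLY AS USED IN THE PROOF OF [SemiAnbd] Cor. 2.7 (i)** — see the
TOKEN in the module docstring (abc-iut-L3-lead ζ22); Cor. 2.7 (i) itself is already unconditional in
the tree (`Corollary27iHolds.lean`), this is (D3) for ABSTRACT `φ` (p. 30,
"[as one verifies immediately] `ℋ′` injects into `𝒢′` as a subgraph"): for connected `𝒢` with
`Π_v → Π_𝒢` injective at every vertex, EVERY `A ∈ B(𝒢)`, every `φ : 𝒢′ → 𝒢` from a connected `𝒢′`
which is locally and globally the covering attached to `A` and vertex-aligned (Def. 2.2 (i) at the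
TYPED notion of morphism, NO branch alignment), and every connected sub-GRAPH `ℍ ∋ φ(v′)` ALL OF WHOSE
VERTICES ARE ELEVATED (Def. 2.4 (i)): (P1) the preimage components of `ℍ` correspond bijectively to
`Π_ℍ \ Π_𝒢 / Π′`, (P2) the component through `v′` exists, (P3) it goes to the class of `Π′` with
`ι(Π_{K₀}) = Π′ ∩ Π_ℍ`, (P4) `ι(Π_K) = Π′ ∩ g⁻¹ Π_ℍ g`.  NEW STATEMENT SHAPE: the body of
`covering_subgraphComponents_doubleCosets` with print's hypothesis «the vertices of `ℍ` are elevated»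
inserted — NOT the typed fact (which has no such hypothesis and stays OPEN-AS-TYPED).  Proof: detection
is needed only for the cells over `ℍ.edges` (E2c
`covering_subgraphComponents_doubleCosets_of_sectionE_surjectiveOn`); such an edge is closed with both
ends in `ℍ`, hence elevated, hence both sides of every cell over it are Π-essential
(`exists_not_mem_map_branchSubgroup_of_isElevated` at the open stabiliser of a point over the cell,
identity frames), so R6a `BObj.port_of_essential` gives a port, which detects the cell
(`Hom.sectionE_detected_of_port`). [cite: MochizukiSemiAnbd2006, Cor. 2.7(i) p.30] -/

theorem covering_subgraphComponents_doubleCosets_of_isElevated :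
    ∀ (𝒢 𝒢' : SemiGraphOfAnabelioids.{v₁, u₁, u}) (φ : Hom 𝒢' 𝒢) (A : 𝒢.BObj),
      𝒢.IsConnected → 𝒢'.IsConnected → φ.IsFiniteEtaleCoveringOf A → φ.IsGlobalCoveringOf A →
      φ.IsVertexAligned →
      (∀ (v : 𝒢.graph.Vertex) (F : 𝒢.V v ⥤ FintypeCat.{v₁}) [FiberFunctor F],
          Function.Injective (𝒢.piVToPi v F)) →
      ∀ (v' : 𝒢'.graph.Vertex) (F' : 𝒢'.V v' ⥤ FintypeCat.{v₁}) [FiberFunctor F']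
        (F : 𝒢.V (φ.base.vertexMap v') ⥤ FintypeCat.{v₁}) [FiberFunctor F]
        (e : (φ.φV v').pullback ⋙ F' ≅ F)
        (H : 𝒢.graph.Subgraph), H.toSemiGraph.IsConnected → H.toSemiGraph.IsGraph →
        (∀ w : H.toSemiGraph.Vertex, 𝒢.IsElevated w.1) →
        ∀ (hv : φ.base.vertexMap v' ∈ H.verts),
        let v := φ.base.vertexMap v'
        let ι : 𝒢'.Pi v' F' →* 𝒢.Pi v F :=
          (Aut.autMulEquivOfIso (Functor.isoWhiskerLeft (𝒢.ρ v) e)).toMonoidHom.comp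
            (pi1Map φ.pullbackFunctor (𝒢'.ρ v' ⋙ F'))
        let PH : Subgroup (𝒢.Pi v F) := (𝒢.piHToPi H ⟨v, hv⟩ F).range
        ∀ x₀ : (𝒢.ρ v ⋙ F).obj A, ι.range = MulAction.stabilizer (𝒢.Pi v F) x₀ →
          ∃ d : {K : 𝒢'.graph.Subgraph // φ.IsPreimageComponent H K} → 𝒢.Pi v F,
            Function.Bijective (fun K => DoubleCoset.mk PH ι.range (d K)) ∧
            (∃ K₀ : {K : 𝒢'.graph.Subgraph // φ.IsPreimageComponent H K}, v' ∈ K₀.1.verts) ∧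
            (∀ (K : {K : 𝒢'.graph.Subgraph // φ.IsPreimageComponent H K}) (hK : v' ∈ K.1.verts),
              d K ∈ ι.range ∧ (ι.comp (𝒢'.piHToPi K.1 ⟨v', hK⟩ F')).range = ι.range ⊓ PH) ∧
            ∀ (K : {K : 𝒢'.graph.Subgraph // φ.IsPreimageComponent H K})
              (w'' : K.1.toSemiGraph.Vertex) (F'' : 𝒢'.V w''.1 ⥤ FintypeCat.{v₁}) [FiberFunctor F'']
              (α : 𝒢'.ρ w''.1 ⋙ F'' ≅ 𝒢'.ρ v' ⋙ F'),
              ∃ g : 𝒢.Pi v F,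
                (ι.comp ((Aut.autMulEquivOfIso α).toMonoidHom.comp (𝒢'.piHToPi K.1 w'' F''))).range =
                  ι.range ⊓ ConjAct.toConjAct g⁻¹ • PH := by
  intro 𝒢 𝒢' φ A h𝒢 h𝒢' hloc hB hva hinj v' F' _ F _ e H hH hHg hel hv v ι PH x₀ hx₀
  obtain ⟨hprod, α, hα, ⟨eB⟩⟩ := hB
  haveI := hprod
  haveI := hα
  refine covering_subgraphComponents_doubleCosets_of_sectionE_surjectiveOn φ A α eB h𝒢 h𝒢' hloc hva
    v' F' F e H hH hHg hv ?_ x₀ hx₀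
  intro e₁ he₁ Q
  classical
  letI := 𝒢.galoisCategory_bObj h𝒢
  -- the two branches of `e₁`; both abut (ℍ is a graph) to elevated vertices (of ℍ)
  obtain ⟨b₀, b₁, hne, hb₀, hb₁, -⟩ := 𝒢.graph.two_branches e₁
  subst hb₀
  obtain ⟨v₁, h₀⟩ := Option.isSome_iff_exists.mp (𝒢.isSome_abuts_of_mem_edges H hHg he₁ b₀ rfl)
  obtain ⟨v₂, h₁⟩ := Option.isSome_iff_exists.mp (𝒢.isSome_abuts_of_mem_edges H hHg he₁ b₁ hb₁)
  have hel₁ : 𝒢.IsElevated v₁ := hel ⟨v₁, 𝒢.mem_verts_of_abuts_of_mem_edges H hHg he₁ h₀⟩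
  have hel₂ : 𝒢.IsElevated v₂ := hel ⟨v₂, 𝒢.mem_verts_of_abuts_of_mem_edges H hHg (hb₁ ▸ he₁) h₁⟩
  -- identity frames
  let Fe := GaloisCategory.getFiberFunctor (𝒢.E (𝒢.graph.edgeOf b₀))
  let F₁ : 𝒢.V v₁ ⥤ FintypeCat.{v₁} := (𝒢.pull b₀ v₁ h₀).pullback ⋙ Fe
  haveI : FiberFunctor F₁ := fiberFunctor_comp_of_exact _ Fe
  haveI : FiberFunctor (𝒢.ρ v₁ ⋙ F₁) := 𝒢.fiberFunctor_ρ h𝒢 v₁ F₁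
  let Fe' := GaloisCategory.getFiberFunctor (𝒢.E (𝒢.graph.edgeOf b₁))
  let F₂ : 𝒢.V v₂ ⥤ FintypeCat.{v₁} := (𝒢.pull b₁ v₂ h₁).pullback ⋙ Fe'
  haveI : FiberFunctor F₂ := fiberFunctor_comp_of_exact _ Fe'
  haveI : FiberFunctor (𝒢.ρ v₂ ⋙ F₂) := 𝒢.fiberFunctor_ρ h𝒢 v₂ F₂
  -- the cell over the other branch, points over the cell, essential witnesses
  obtain ⟨Q₁, hQ₁⟩ : ∃ Q₁ : π₀Obj (A.T (𝒢.graph.edgeOf b₁)),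
      (⟨𝒢.graph.edgeOf b₁, Q₁⟩ : Σ e, π₀Obj (A.T e)) = ⟨𝒢.graph.edgeOf b₀, Q⟩ := by
    rw [hb₁]
    exact ⟨Q, rfl⟩
  obtain ⟨a₁, ha₁⟩ := A.exists_point_over_cell b₀ v₁ h₀ Fe Q
  obtain ⟨a₂, ha₂⟩ := A.exists_point_over_cell b₁ v₂ h₁ Fe' Q₁
  obtain ⟨u₁, hu₁, hn₁⟩ := exists_not_mem_map_branchSubgroup_of_isElevated hel₁ F₁ (hinj v₁ F₁) b₀ h₀
    Fe (Iso.refl _) (MulAction.stabilizer (𝒢.PiV v₁ F₁) a₁) (stabilizer_isOpen (𝒢.PiV v₁ F₁) a₁)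
  obtain ⟨u₂, hu₂, hn₂⟩ := exists_not_mem_map_branchSubgroup_of_isElevated hel₂ F₂ (hinj v₂ F₂) b₁ h₁
    Fe' (Iso.refl _) (MulAction.stabilizer (𝒢.PiV v₂ F₂) a₂) (stabilizer_isOpen (𝒢.PiV v₂ F₂) a₂)
  -- R6a: a port; it detects the cell
  obtain ⟨Y, hY, g, bc, vc₀, vc₁, bc₁, h₀', h₁', hne', he', hreach', Q', hQ', hcQ⟩ :=
    BObj.port_of_essential h𝒢 A F₁ b₀ h₀ Fe (Iso.refl _) Q a₁ ha₁
      ⟨u₁, MulAction.mem_stabilizer_iff.mp hu₁, hn₁⟩ F₂ b₁ hne.symm h₁ Fe' (Iso.refl _) Q₁ hQ₁ a₂ ha₂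
      ⟨u₂, MulAction.mem_stabilizer_iff.mp hu₂, hn₂⟩
  haveI := hY
  obtain ⟨e', Q'', hQ'', hk⟩ := φ.sectionE_detected_of_port A α eB g
    (fun u _ => Anabelioids.isIso_of_isConnected_of_endo u) bc h₀' h₁' hne' he' hreach' Q' hcQ
  exact ⟨e', Q'', hQ''.trans hQ', hk⟩

/-- **(D3) under the standing hypotheses of [SemiAnbd] Cor. 2.7 (i), verbatim**: `𝒢` a connected,
quasi-coherent GRAPH of anabelioids (so `Π_v ↪ Π_𝒢`, Prop. 2.5 (i), abc-iut's `piVToPi_injective`),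
`ℍ` a connected sub-graph all of whose vertices are elevated — then the body of (D3) for every `A` and
every covering (local ∧ global ∧ vertex-aligned, NO branch alignment).  Same NEW statement shape as
`covering_subgraphComponents_doubleCosets_of_isElevated`; NOT the typed fact. [cite: MochizukiSemiAnbd2006, Cor. 2.7(i) p.30] -/

theorem covering_subgraphComponents_doubleCosets_of_isElevated_of_isQuasiCoherent :
    ∀ (𝒢 𝒢' : SemiGraphOfAnabelioids.{v₁, u₁, u}) (φ : Hom 𝒢' 𝒢) (A : 𝒢.BObj),
      𝒢.IsConnected → 𝒢'.IsConnected → φ.IsFiniteEtaleCoveringOf A → φ.IsGlobalCoveringOf A →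
      φ.IsVertexAligned →
      𝒢.IsGraphOfAnabelioids → 𝒢.IsQuasiCoherent →
      ∀ (v' : 𝒢'.graph.Vertex) (F' : 𝒢'.V v' ⥤ FintypeCat.{v₁}) [FiberFunctor F']
        (F : 𝒢.V (φ.base.vertexMap v') ⥤ FintypeCat.{v₁}) [FiberFunctor F]
        (e : (φ.φV v').pullback ⋙ F' ≅ F)
        (H : 𝒢.graph.Subgraph), H.toSemiGraph.IsConnected → H.toSemiGraph.IsGraph →
        (∀ w : H.toSemiGraph.Vertex, 𝒢.IsElevated w.1) →
        ∀ (hv : φ.base.vertexMap v' ∈ H.verts),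
        let v := φ.base.vertexMap v'
        let ι : 𝒢'.Pi v' F' →* 𝒢.Pi v F :=
          (Aut.autMulEquivOfIso (Functor.isoWhiskerLeft (𝒢.ρ v) e)).toMonoidHom.comp
            (pi1Map φ.pullbackFunctor (𝒢'.ρ v' ⋙ F'))
        let PH : Subgroup (𝒢.Pi v F) := (𝒢.piHToPi H ⟨v, hv⟩ F).range
        ∀ x₀ : (𝒢.ρ v ⋙ F).obj A, ι.range = MulAction.stabilizer (𝒢.Pi v F) x₀ →
          ∃ d : {K : 𝒢'.graph.Subgraph // φ.IsPreimageComponent H K} → 𝒢.Pi v F,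
            Function.Bijective (fun K => DoubleCoset.mk PH ι.range (d K)) ∧
            (∃ K₀ : {K : 𝒢'.graph.Subgraph // φ.IsPreimageComponent H K}, v' ∈ K₀.1.verts) ∧
            (∀ (K : {K : 𝒢'.graph.Subgraph // φ.IsPreimageComponent H K}) (hK : v' ∈ K.1.verts),
              d K ∈ ι.range ∧ (ι.comp (𝒢'.piHToPi K.1 ⟨v', hK⟩ F')).range = ι.range ⊓ PH) ∧
            ∀ (K : {K : 𝒢'.graph.Subgraph // φ.IsPreimageComponent H K})
              (w'' : K.1.toSemiGraph.Vertex) (F'' : 𝒢'.V w''.1 ⥤ FintypeCat.{v₁}) [FiberFunctor F'']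
              (α : 𝒢'.ρ w''.1 ⋙ F'' ≅ 𝒢'.ρ v' ⋙ F'),
              ∃ g : 𝒢.Pi v F,
                (ι.comp ((Aut.autMulEquivOfIso α).toMonoidHom.comp (𝒢'.piHToPi K.1 w'' F''))).range =
                  ι.range ⊓ ConjAct.toConjAct g⁻¹ • PH := by
  intro 𝒢 𝒢' φ A h𝒢 h𝒢' hloc hB hva hgr hqc
  exact covering_subgraphComponents_doubleCosets_of_isElevated 𝒢 𝒢' φ A h𝒢 h𝒢' hloc hB hva
    (fun v F _ => piVToPi_injective hgr hqc v F)

end SemiGraphOfAnabelioids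

end Literature.AnabelianGeometry.SemiGraphs
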